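import Summits.MatrixMultiplication.MatrixMultiplication.Theses.SnSubsetDichotomy
import Literature.NumberTheory.DiophantineGeometry.PartitionTableaux
import Literature.NumberTheory.DiophantineGeometry.SymmetricGroupReps
import Literature.RepresentationTheory.FiniteGroups.WedderburnBlocks
import Literature.RepresentationTheory.FiniteGroups.UnitaryWedderburn
import Literature.RepresentationTheory.FiniteGroups.FourierInversionIdentity
import Literature.Combinatorics.Additive.TPPGroupAlgebra
import Literature.Barriers.MatrixMultiplication.QuasirandomBarrierProofs
import Summits.MatrixMultiplication.MatrixMultiplication.Theorems.SnSubsetDichotomyGlobalBranchStubBlockDictionary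
import Summits.MatrixMultiplication.MatrixMultiplication.Theorems.SnSubsetDichotomyGlobalBranchStubTruncatedCount
import Summits.MatrixMultiplication.MatrixMultiplication.Theorems.SnSubsetDichotomyGlobalBranchStubDimGrowth
import Summits.MatrixMultiplication.MatrixMultiplication.Theorems.SnSubsetDichotomyGlobalBranchStubFlatCase
import Summits.MatrixMultiplication.MatrixMultiplication.Theorems.SnSubsetDichotomyGlobalBranchStubUmvirateParseval

/-!
# Line `flat-tail-truncation` for crux `GlobalBranch` (stmt-MatrixMultiplication-8303) — LEAD'S SKELETON (v5: all provable stubs LANDED; imported except the newest module; sorries = the residual + the just-landed stub 10)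

Reshaped by the line lead from the planner's `Lines/flat_tail_truncation.lean` (see `PICKED.md`):

* flatness is SPECTRAL: `specMass ℓ X = |X|⁻² Σ_{μ ≠ (n), μ₁ = n-ℓ} Σ_{x,y ∈ X} Re χ^μ(x⁻¹y)` (the
  Hilbert–Schmidt mass of `1_X` on the level-`ℓ` irreducibles, written with characters only) and its
  column version `specMassT` (`μ₁' = n-ℓ`); by the umvirate Parseval inequality `specMass ℓ X ≤ umvFlat ℓ X`,
  so the flat case below is STRONGER than the planner's and the residual stubs WEAKER;
* `stub_truncatedCount` is split into `stub_blockTruncation` (any finite group, any unitary Wedderburn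
  decomposition, any labelling of the blocks into "positivity/high" and low families: pure matrix analysis,
  the level-`L` version of the tree's `BCGPU2023_thm32_holds`), `stub_blockDictionary` (blocks of `ℂ[𝔖ₙ]`
  ↔ partitions, degrees `f^μ`, norms as character sums) and `stub_partitionNumerics` (end shapes and the
  bound `f^μ ≤ n^{(ℓ)}` at level `ℓ`), assembled here WITHOUT sorry (`truncatedCount`);
* `stub_dimGrowth` asks for `f^μ ≥ e^{c√n}` beyond two-ended level `⌊√n⌋` for SOME `c > 0`; the flat case
  then gives `V ≤ (n!)^{3/2} e^{-(min c 4/4)√n}`;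
* the two residual stubs (open) keep their shape, with the spectral `FlatAt`.
`GlobalBranch_of : GlobalBranch` is proved from the six stubs (kernel-checked composition).
-/

set_option linter.dupNamespace false
set_option linter.unusedVariables false
set_option linter.unusedSectionVars false

open scoped BigOperators Matrix ComplexOrder
open Finset

namespace Summit.MatrixMultiplication.MatrixMultiplication.Cruxes.GlobalBranch.FlatTailTruncation

open Literature.Combinatorics.Additive (TripleProductProperty indicatorElem indicatorElemInv)
open Literature.NumberTheory.DiophantineGeometry (numStandardTableaux spechtCharacter)
open Literature.RepresentationTheory.FiniteGroups (BlockAlgebraC blockRep)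
open Summit.MatrixMultiplication.MatrixMultiplication.Theses.SnSubsetDichotomy (GlobalBranch)

noncomputable section

variable {n : ℕ}

/-! ## Vocabulary of the line -/

/-- The character sum `Σ_{x,y ∈ X} Re χ^μ(x⁻¹y)` (= `‖1̂_X(μ)‖²_HS` in any unitary realisation). -/
def charSum (μ : Nat.Partition n) (X : Finset (Equiv.Perm (Fin n))) : ℝ :=
  ∑ x ∈ X, ∑ y ∈ X, (spechtCharacter ℂ μ (x⁻¹ * y)).re

/-- The level-`ℓ` (first-ROW) family of partitions: `μ ≠ (n)` with largest part `n - ℓ`. -/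
def rowFamily (n ℓ : ℕ) : Finset (Nat.Partition n) :=
  univ.filter (fun μ => μ ≠ Nat.Partition.indiscrete n ∧ μ.parts.sup = n - ℓ)

/-- The level-`ℓ` (first-COLUMN) family: `μ ≠ (n)` with `n - ℓ` parts. -/
def colFamily (n ℓ : ℕ) : Finset (Nat.Partition n) :=
  univ.filter (fun μ => μ ≠ Nat.Partition.indiscrete n ∧ Multiset.card μ.parts = n - ℓ)

/-- **Spectral level-`ℓ` mass** of `X ⊆ 𝔖ₙ` (row family): `|X|⁻² Σ_{μ ∈ rowFamily} Σ_{x,y∈X} Re χ^μ(x⁻¹y)`. -/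
def specMass (ℓ : ℕ) (X : Finset (Equiv.Perm (Fin n))) : ℝ :=
  (∑ μ ∈ rowFamily n ℓ, charSum μ X) / ((X.card : ℝ) ^ 2)

/-- **Spectral level-`ℓ` mass**, column family (the sign-twisted blocks). -/
def specMassT (ℓ : ℕ) (X : Finset (Equiv.Perm (Fin n))) : ℝ :=
  (∑ μ ∈ colFamily n ℓ, charSum μ X) / ((X.card : ℝ) ^ 2)

/-- The **low-level weight** of a triple up to level `L`. -/
def lowWeight (L : ℕ) (S T U : Finset (Equiv.Perm (Fin n))) : ℝ :=
  ∑ ℓ ∈ Finset.Ico 1 (L + 1), (n.descFactorial ℓ : ℝ) *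
    (specMass ℓ S * specMass ℓ T * specMass ℓ U + specMassT ℓ S * specMassT ℓ T * specMassT ℓ U)

/-- The **two-ended level** of `μ ⊢ n`: `n - max(μ₁, μ₁')`. -/
def lvl2 (μ : Nat.Partition n) : ℕ :=
  n - max μ.parts.sup (Multiset.card μ.parts)

/-- **Spectral flatness of one set at level `ℓ`** (cube form): `n^{(ℓ)}·(specMass ℓ X)³ ≤ 8^{-ℓ}` and the
same for `specMassT`. -/
def FlatAt (ℓ : ℕ) (X : Finset (Equiv.Perm (Fin n))) : Prop :=
  (n.descFactorial ℓ : ℝ) * specMass ℓ X ^ 3 ≤ (1 / 8 : ℝ) ^ ℓ ∧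
    (n.descFactorial ℓ : ℝ) * specMassT ℓ X ^ 3 ≤ (1 / 8 : ℝ) ^ ℓ

/-- **Bump-freeness** at exponent `ε` — VERBATIM the hypothesis of the crux `GlobalBranch`. -/
def BumpFree (ε : ℝ) (S T U : Finset (Equiv.Perm (Fin n))) : Prop :=
  ∀ X : Finset (Equiv.Perm (Fin n)), (X = S ∨ X = T ∨ X = U) → ∀ t : ℕ, 1 ≤ t →
    (t : ℝ) ≤ Real.sqrt (n : ℝ) → ∀ I L : Fin t → Fin n, Function.Injective I →
      Function.Injective L →
        ((X.filter (fun σ => ∀ k, σ (I k) = L k)).card : ℝ) * (n.descFactorial t : ℝ) ≤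
          (n : ℝ) ^ ((1 / 2 + ε) * t) * (X.card : ℝ)

/-! ## The stubs -/

/-! STUBS 1 and 3 (`stub_blockTruncation`, `stub_partitionNumerics`) are LANDED —
`Theorems/SnSubsetDichotomyGlobalBranchStub{BlockTruncation,PartitionNumerics}.lean` (p85681, p87857),
namespace `Summit.MatrixMultiplication.MatrixMultiplication.Theorems.GlobalBranch` — and consumed by the
assembly `stub_truncatedCount` (work/stubs/stub_truncatedCount.lean, to land as `…StubTruncatedCount.lean`);
they are no longer restated here.  STUB 2 is landed too (p86940) and restated (it is used by the
non-negativity glue below); its `sorry` is discharged by the tree theorem of the same name once the farm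
serves the new module. -/

/-- **STUB 2 — the block dictionary of `ℂ[𝔖ₙ]`** (LANDED: `Theorems/SnSubsetDichotomyGlobalBranchStubBlockDictionary.lean`,
p86940).  For any unitary Wedderburn decomposition `φ` of `ℂ[𝔖ₙ]`: the blocks are in bijection with the
partitions of `n` (`part`), block `i` has character `χ^{part i}` and size `f^{part i}`, the trivial block
is `(n)`, and the Hilbert–Schmidt norm of the `i`-th block of `1̂_X` is the character sum
`Σ_{x,y∈X} Re χ^{part i}(x⁻¹y)`. -/
theorem stub_blockDictionary (n : ℕ) {r : ℕ} {d : Fin r → ℕ} [∀ i, NeZero (d i)]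
    (φ : MonoidAlgebra ℂ (Equiv.Perm (Fin n)) ≃ₐ[ℂ] BlockAlgebraC d)
    (hφ : ∀ (g : Equiv.Perm (Fin n)) (i : Fin r),
      (φ (MonoidAlgebra.single g 1) i)ᴴ * φ (MonoidAlgebra.single g 1) i = 1) :
    ∃ part : Fin r → Nat.Partition n, Function.Bijective part ∧
      (∀ i, (blockRep φ i).character = spechtCharacter ℂ (part i)) ∧
      (∀ i, d i = numStandardTableaux (part i)) ∧
      (∀ i, d i = 1 → (∀ g : Equiv.Perm (Fin n), φ (MonoidAlgebra.single g 1) i = 1) →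
        part i = Nat.Partition.indiscrete n) ∧
      (∀ (i : Fin r) (X : Finset (Equiv.Perm (Fin n))),
        ((φ (indicatorElem ℂ X) i)ᴴ * φ (indicatorElem ℂ X) i).trace.re =
          ∑ x ∈ X, ∑ y ∈ X, (spechtCharacter ℂ (part i) (x⁻¹ * y)).re) :=
  Summit.MatrixMultiplication.MatrixMultiplication.Theorems.GlobalBranch.stub_blockDictionary n φ hφ

/-- **STUB 4 — dimension growth beyond two-ended level `⌊√n⌋`.**  For some `c > 0` and all large `n`:
every `μ ⊢ n` with `μ₁ ≤ n - ⌊√n⌋ - 1` and `μ₁' ≤ n - ⌊√n⌋ - 1` has `f^μ ≥ e^{c√n}`.  Route (lead's notes):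
WLOG `μ₁ ≥ μ₁'` (`f^{μᵀ} = f^μ`); peel the first row in the hook length formula — the hooks of rows `≥ 2` are
bounded through `h ≤ (arm+1)(leg+1)` and `Π_i ν_i! Π_j ν'_j! ≤ |ν|!`, the hooks of row 1 are
`μ₁ - j + μ'_j` — giving `f^μ ≥ C(n, n-μ₁)·C(μ₁, μ₂)/C(μ₁+μ₁'-1, μ₂)`, then a two-case estimate
(`μ₂ ≤ μ₁/2` / `μ₂ > μ₁/2`).  Any `c > 0` serves the line (numerics: the minimum over the range is the
two-row shape `(n-⌊√n⌋-1, ⌊√n⌋+1)`, `≈ e^{√n(½ log n + 1)}`). -/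
theorem stub_dimGrowth :
    ∃ c : ℝ, 0 < c ∧ ∃ n₁ : ℕ, ∀ n ≥ n₁, ∀ μ : Nat.Partition n,
      Nat.sqrt n < n - max μ.parts.sup (Multiset.card μ.parts) →
        Real.exp (c * Real.sqrt (n : ℝ)) ≤ (numStandardTableaux μ : ℝ) :=
  Summit.MatrixMultiplication.MatrixMultiplication.Theorems.GlobalBranch.stub_dimGrowth

/-- **STUB 7 (assembly, held by the lead)** — the two-ended level-`L` truncation of the BCGPU
identity for `𝔖ₙ` with SPECTRAL low weight, vocabulary-free form: for `n ≥ 1`, every `L`, every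
`D > 0` below all `f^μ` of two-ended level `> L`, and every TPP triple,
`V² ≤ n!·V + (n!)^{3/2}·V/√D + V²·Σ_{ℓ=1}^{L} n^{(ℓ)}(sM ℓ S sM ℓ T sM ℓ U + sT ℓ S sT ℓ T sT ℓ U)`
for any functions `sM`, `sT` satisfying the defining equations of `specMass`, `specMassT`.
Assembly of stubs 1–3 (see `Theorems/SnSubsetDichotomyGlobalBranchStubTruncatedCount.lean`). -/
theorem stub_truncatedCount (n L : ℕ) (hn : 1 ≤ n) (D : ℝ) (hD : 0 < D)
    (hdim : ∀ μ : Nat.Partition n, L < n - max μ.parts.sup (Multiset.card μ.parts) →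
      D ≤ (numStandardTableaux μ : ℝ))
    (sM sT : ℕ → Finset (Equiv.Perm (Fin n)) → ℝ)
    (hsM : ∀ (ℓ : ℕ) (X : Finset (Equiv.Perm (Fin n))), sM ℓ X =
      (∑ μ ∈ univ.filter (fun μ : Nat.Partition n =>
          μ ≠ Nat.Partition.indiscrete n ∧ μ.parts.sup = n - ℓ),
        ∑ x ∈ X, ∑ y ∈ X, (spechtCharacter ℂ μ (x⁻¹ * y)).re) / ((X.card : ℝ) ^ 2))
    (hsT : ∀ (ℓ : ℕ) (X : Finset (Equiv.Perm (Fin n))), sT ℓ X =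
      (∑ μ ∈ univ.filter (fun μ : Nat.Partition n =>
          μ ≠ Nat.Partition.indiscrete n ∧ Multiset.card μ.parts = n - ℓ),
        ∑ x ∈ X, ∑ y ∈ X, (spechtCharacter ℂ μ (x⁻¹ * y)).re) / ((X.card : ℝ) ^ 2))
    (S T U : Finset (Equiv.Perm (Fin n))) (hTPP : TripleProductProperty S T U) :
    ((S.card * T.card * U.card : ℕ) : ℝ) ^ 2 ≤
      (n.factorial : ℝ) * ((S.card * T.card * U.card : ℕ) : ℝ) +
        (n.factorial : ℝ) ^ ((3 : ℝ) / 2) * ((S.card * T.card * U.card : ℕ) : ℝ) / Real.sqrt D +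
        ((S.card * T.card * U.card : ℕ) : ℝ) ^ 2 *
          ∑ ℓ ∈ Finset.Ico 1 (L + 1), (n.descFactorial ℓ : ℝ) *
            (sM ℓ S * sM ℓ T * sM ℓ U + sT ℓ S * sT ℓ T * sT ℓ U) :=
  Summit.MatrixMultiplication.MatrixMultiplication.Theorems.GlobalBranch.stub_truncatedCount n L hn D hD hdim sM sT hsM hsT S T U hTPP

/-- The truncated count in the line's vocabulary (`lvl2`, `lowWeight`), from stub 7. -/
theorem truncatedCount (n L : ℕ) (hn : 1 ≤ n) (D : ℝ) (hD : 0 < D)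
    (hdim : ∀ μ : Nat.Partition n, L < lvl2 μ → D ≤ (numStandardTableaux μ : ℝ))
    (S T U : Finset (Equiv.Perm (Fin n))) (hTPP : TripleProductProperty S T U) :
    ((S.card * T.card * U.card : ℕ) : ℝ) ^ 2 ≤
      (n.factorial : ℝ) * ((S.card * T.card * U.card : ℕ) : ℝ) +
        (n.factorial : ℝ) ^ ((3 : ℝ) / 2) * ((S.card * T.card * U.card : ℕ) : ℝ) / Real.sqrt D +
        ((S.card * T.card * U.card : ℕ) : ℝ) ^ 2 * lowWeight L S T U :=
  stub_truncatedCount n L hn D hD hdim specMass specMassT (fun _ _ => rfl) (fun _ _ => rfl) S T U hTPP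


/-- **STUB 5 — the coherent residual** (open; HARDEST, held by the lead; crux-sized).  For some bump
exponent `ε > 0`: every `(1/2+ε)`-bump-free TPP triple in `𝔖ₙ` one of whose sets is spectrally NON-flat
at some level `1 ≤ ℓ ≤ ⌊√n⌋` is sub-threshold.  It is `GlobalBranch` restricted to the complement of the
flat case (so it is implied by `GlobalBranch`, hence by `¬ThresholdSubsetTriples`, and is not refutable
short of `ω = 2`, Disproof §1).  Two zones (the planner's split, kept as guidance): BOUNDED witness level
(`ℓ ≤ ℓ₀`: the structured hosts — Young cosets at `ℓ = 1`, the matching centralisers `B(M) = S₂ ≀ S_{n/2}`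
at `ℓ = 2`, where every non-empty subset of a two-sided coset `gB(M)h` has `specMass 2 ≥ 1` because
`S^{(n-2,2)}` has a `B(M)`-fixed vector: this zone contains the bump-free core of crux
`HyperoctahedralSubsets`, stmt-8305) and GROWING witness level (all sets flat up to `ℓ₀`, a witness above:
the pseudorandom-to-order-`ℓ₀` zone where level-`ℓ` inequalities would have to act at density `n!^{-1/2}`,
route Numbers O1).  No engine is known for either zone (triage r1 census; lead's analysis in
`residual-S5.md`). -/
theorem stub_coherentResidual :
    ∃ ε : ℝ, 0 < ε ∧ ∃ c : ℝ, 0 < c ∧ ∃ n₀ : ℕ, ∀ n ≥ n₀,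
      ∀ S T U : Finset (Equiv.Perm (Fin n)), TripleProductProperty S T U → BumpFree ε S T U →
        (∃ X : Finset (Equiv.Perm (Fin n)), (X = S ∨ X = T ∨ X = U) ∧
          ∃ ℓ : ℕ, 1 ≤ ℓ ∧ ℓ ≤ Nat.sqrt n ∧ ¬ FlatAt ℓ X) →
        ((S.card * T.card * U.card : ℕ) : ℝ) ≤
          (n.factorial : ℝ) ^ ((3 : ℝ) / 2) * Real.exp (-(c * Real.sqrt (n : ℝ))) := by
  sorry

/-- **STUB 8 — the flat case** (vocabulary-free form, to be LANDED as
`Theorems/SnSubsetDichotomyGlobalBranchStubFlatCase.lean`; proved there from stubs 4 + 7): for some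
absolute `c > 0` and all large `n`, a TPP triple all of whose sets satisfy the cube flatness condition
`n^{(ℓ)}·(sM ℓ X)³ ≤ 8^{-ℓ}`, `n^{(ℓ)}·(sT ℓ X)³ ≤ 8^{-ℓ}` at every level `1 ≤ ℓ ≤ ⌊√n⌋` (for the
spectral masses `sM = specMass`, `sT = specMassT`, entering as pinned function parameters) has
`|S||T||U| ≤ (n!)^{3/2} e^{-c√n}`. -/
theorem stub_flatCase :
    ∃ c : ℝ, 0 < c ∧ ∃ n₃ : ℕ, ∀ n ≥ n₃,
      ∀ (sM sT : ℕ → Finset (Equiv.Perm (Fin n)) → ℝ),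
      (∀ (ℓ : ℕ) (X : Finset (Equiv.Perm (Fin n))), sM ℓ X =
        (∑ μ ∈ univ.filter (fun μ : Nat.Partition n =>
            μ ≠ Nat.Partition.indiscrete n ∧ μ.parts.sup = n - ℓ),
          ∑ x ∈ X, ∑ y ∈ X, (spechtCharacter ℂ μ (x⁻¹ * y)).re) / ((X.card : ℝ) ^ 2)) →
      (∀ (ℓ : ℕ) (X : Finset (Equiv.Perm (Fin n))), sT ℓ X =
        (∑ μ ∈ univ.filter (fun μ : Nat.Partition n =>
            μ ≠ Nat.Partition.indiscrete n ∧ Multiset.card μ.parts = n - ℓ),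
          ∑ x ∈ X, ∑ y ∈ X, (spechtCharacter ℂ μ (x⁻¹ * y)).re) / ((X.card : ℝ) ^ 2)) →
      ∀ S T U : Finset (Equiv.Perm (Fin n)), TripleProductProperty S T U →
      (∀ X : Finset (Equiv.Perm (Fin n)), (X = S ∨ X = T ∨ X = U) →
        ∀ ℓ : ℕ, 1 ≤ ℓ → ℓ ≤ Nat.sqrt n →
          (n.descFactorial ℓ : ℝ) * sM ℓ X ^ 3 ≤ (1 / 8 : ℝ) ^ ℓ ∧
            (n.descFactorial ℓ : ℝ) * sT ℓ X ^ 3 ≤ (1 / 8 : ℝ) ^ ℓ) →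
      ((S.card * T.card * U.card : ℕ) : ℝ) ≤
        (n.factorial : ℝ) ^ ((3 : ℝ) / 2) * Real.exp (-(c * Real.sqrt (n : ℝ))) :=
  Summit.MatrixMultiplication.MatrixMultiplication.Theorems.GlobalBranch.stub_flatCase

/-- **STUB 9 — the umvirate Parseval inequality** (Young's rule content; makes the spectral flatness
COMBINATORIAL): for every coefficient function `f` on `𝔖ₙ` and `ℓ ≤ n`, the Hilbert–Schmidt mass of
`f` on the irreducibles `S^μ`, `μ ≠ (n)`, with first row `μ₁ ≥ n - ℓ`, written as the character sums
`Re Σ_{x,y} f̄(x) f(y) χ^μ(x⁻¹y)`, is at most `Σ_{I,L} |f(U_{I→L})|² - |f(𝔖ₙ)|²`, where `U_{I→L} = {σ : σ∘I = L}`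
runs over the `ℓ`-umvirates (injective `I, L : Fin ℓ ↪ Fin n`).  With `f = 1_X` this reads
`|X|²·specMass ℓ X ≤ Σ_{I,L}|X ∩ U_{I→L}|² - |X|² = |X|²·umvFlat ℓ X` (and all lower levels at once); with
`f = sgn·1_X` and `χ^{μᵀ} = sgn·χ^μ` it gives the column version.  Route: `Σ_{I,L}|f(U_{I→L})|² =
Σ_{x,y} f̄(x)f(y) ψ_ℓ(x⁻¹y)` with `ψ_ℓ(g) = #{I : g∘I = I}` the permutation character on injective
`ℓ`-tuples; `ψ_ℓ - 1 - Σ_{μ in the family} χ^μ` is a non-negative combination of irreducible characters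
(`⟨ψ_ℓ, χ^μ⟩ = |H|⁻¹Σ_{h∈H}χ^μ(h) ≥ 1` for `μ₁ ≥ n - ℓ`, `H` the pointwise stabiliser of `ℓ` points, because
the Young symmetrizer `c_μ` is `H`-fixed: tree `EllisFriedgutPilpel2011.fixSum_mul_rowSymmetrizer` /
`EllisFriedgutPilpel2011_thm7_holds`; `⟨ψ_ℓ, 1⟩ = 1`), and every `Σ_{x,y} f̄(x)f(y)χ^ν(x⁻¹y)` is `≥ 0`
(a Hilbert–Schmidt norm, `stub_blockDictionary`). -/
theorem stub_umvirateParseval (n ℓ : ℕ) (hℓ : ℓ ≤ n) (f : Equiv.Perm (Fin n) → ℂ) :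
    (∑ μ ∈ univ.filter (fun μ : Nat.Partition n =>
        μ ≠ Nat.Partition.indiscrete n ∧ n - ℓ ≤ μ.parts.sup),
      (∑ x : Equiv.Perm (Fin n), ∑ y : Equiv.Perm (Fin n),
        (starRingEnd ℂ) (f x) * f y * spechtCharacter ℂ μ (x⁻¹ * y)).re) ≤
      (∑ I : Fin ℓ ↪ Fin n, ∑ L : Fin ℓ ↪ Fin n,
          ‖∑ σ ∈ univ.filter (fun σ : Equiv.Perm (Fin n) => ∀ k, σ (I k) = L k), f σ‖ ^ 2) -
        ‖∑ σ : Equiv.Perm (Fin n), f σ‖ ^ 2 :=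
  Summit.MatrixMultiplication.MatrixMultiplication.Theorems.GlobalBranch.stub_umvirateParseval n ℓ hℓ f

/-- **STUB 10 — the combinatorial flat case** (the planner's original flat case; to be LANDED as
`Theorems/SnSubsetDichotomyGlobalBranchStubFlatCaseUmv.lean`, proved there from stubs 8 + 9): for some
absolute `c > 0` and all large `n`, a TPP triple all of whose sets satisfy the planner's cube flatness
`n^{(ℓ)}·(uF ℓ X)³ ≤ 8^{-ℓ}`, `n^{(ℓ)}·(uS ℓ X)³ ≤ 8^{-ℓ}` at every level `1 ≤ ℓ ≤ ⌊√n⌋` — `uF`, `uS` the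
pinned L²-flatness functionals `umvFlat`, `umvFlatSgn` of the umvirate statistics — has
`|S||T||U| ≤ (n!)^{3/2} e^{-c√n}`. -/
theorem stub_flatCaseUmv :
    ∃ c : ℝ, 0 < c ∧ ∃ n₃ : ℕ, ∀ n ≥ n₃,
      ∀ (uF uS : ℕ → Finset (Equiv.Perm (Fin n)) → ℝ),
      (∀ (ℓ : ℕ) (X : Finset (Equiv.Perm (Fin n))), uF ℓ X =
        ∑ I : Fin ℓ ↪ Fin n, ∑ L : Fin ℓ ↪ Fin n,
          (((X.filter (fun σ => ∀ k, σ (I k) = L k)).card : ℝ) / (X.card : ℝ) -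
            1 / (n.descFactorial ℓ : ℝ)) ^ 2) →
      (∀ (ℓ : ℕ) (X : Finset (Equiv.Perm (Fin n))), uS ℓ X =
        ∑ I : Fin ℓ ↪ Fin n, ∑ L : Fin ℓ ↪ Fin n,
          ((∑ σ ∈ X.filter (fun σ => ∀ k, σ (I k) = L k), ((Equiv.Perm.sign σ : ℤ) : ℝ)) /
              (X.card : ℝ) -
            (∑ σ ∈ X, ((Equiv.Perm.sign σ : ℤ) : ℝ)) / (X.card : ℝ) / (n.descFactorial ℓ : ℝ)) ^ 2) →
      ∀ S T U : Finset (Equiv.Perm (Fin n)), TripleProductProperty S T U →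
      (∀ X : Finset (Equiv.Perm (Fin n)), (X = S ∨ X = T ∨ X = U) →
        ∀ ℓ : ℕ, 1 ≤ ℓ → ℓ ≤ Nat.sqrt n →
          (n.descFactorial ℓ : ℝ) * uF ℓ X ^ 3 ≤ (1 / 8 : ℝ) ^ ℓ ∧
            (n.descFactorial ℓ : ℝ) * uS ℓ X ^ 3 ≤ (1 / 8 : ℝ) ^ ℓ) →
      ((S.card * T.card * U.card : ℕ) : ℝ) ≤
        (n.factorial : ℝ) ^ ((3 : ℝ) / 2) * Real.exp (-(c * Real.sqrt (n : ℝ))) := by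
  -- LANDED: Theorems/SnSubsetDichotomyGlobalBranchStubFlatCaseUmv.lean (p93805) — `Summit.MatrixMultiplication.MatrixMultiplication.Theorems.GlobalBranch.stub_flatCaseUmv`;
  -- the import is withheld only until the farm serves the new module's olean.
  sorry

/-- Level-`ℓ` **L²-flatness** of the umvirate densities of `X ⊆ 𝔖ₙ` (planner's vocabulary):
`umvFlat ℓ X = Σ_{I,L : Fin ℓ ↪ Fin n} (|X ∩ U_{I→L}|/|X| - 1/n^{(ℓ)})²`. -/
def umvFlat (ℓ : ℕ) (X : Finset (Equiv.Perm (Fin n))) : ℝ :=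
  ∑ I : Fin ℓ ↪ Fin n, ∑ L : Fin ℓ ↪ Fin n,
    (((X.filter (fun σ => ∀ k, σ (I k) = L k)).card : ℝ) / (X.card : ℝ) -
      1 / (n.descFactorial ℓ : ℝ)) ^ 2

/-- The **sign-twisted** level-`ℓ` flatness (planner's vocabulary). -/
def umvFlatSgn (ℓ : ℕ) (X : Finset (Equiv.Perm (Fin n))) : ℝ :=
  ∑ I : Fin ℓ ↪ Fin n, ∑ L : Fin ℓ ↪ Fin n,
    ((∑ σ ∈ X.filter (fun σ => ∀ k, σ (I k) = L k), ((Equiv.Perm.sign σ : ℤ) : ℝ)) / (X.card : ℝ) -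
      (∑ σ ∈ X, ((Equiv.Perm.sign σ : ℤ) : ℝ)) / (X.card : ℝ) / (n.descFactorial ℓ : ℝ)) ^ 2

/-- **Flatness in the planner's sense** (cube form on `umvFlat`, `umvFlatSgn`). -/
def FlatAtUmv (ℓ : ℕ) (X : Finset (Equiv.Perm (Fin n))) : Prop :=
  (n.descFactorial ℓ : ℝ) * umvFlat ℓ X ^ 3 ≤ (1 / 8 : ℝ) ^ ℓ ∧
    (n.descFactorial ℓ : ℝ) * umvFlatSgn ℓ X ^ 3 ≤ (1 / 8 : ℝ) ^ ℓ

/-- **The planner's flat case** (in the line's vocabulary), from stub 10: TPP triples all of whose sets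
are `FlatAtUmv` at every level `1 ≤ ℓ ≤ ⌊√n⌋` are sub-threshold. -/
theorem flat_case_umv :
    ∃ c : ℝ, 0 < c ∧ ∃ n₃ : ℕ, ∀ n ≥ n₃, ∀ S T U : Finset (Equiv.Perm (Fin n)),
      TripleProductProperty S T U →
      (∀ X : Finset (Equiv.Perm (Fin n)), (X = S ∨ X = T ∨ X = U) →
        ∀ ℓ : ℕ, 1 ≤ ℓ → ℓ ≤ Nat.sqrt n → FlatAtUmv ℓ X) →
      ((S.card * T.card * U.card : ℕ) : ℝ) ≤
        (n.factorial : ℝ) ^ ((3 : ℝ) / 2) * Real.exp (-(c * Real.sqrt (n : ℝ))) := by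
  obtain ⟨c, hc, n₃, h⟩ := stub_flatCaseUmv
  refine ⟨c, hc, n₃, fun n hn S T U hTPP hflat => ?_⟩
  exact h n hn umvFlat umvFlatSgn (fun _ _ => rfl) (fun _ _ => rfl) S T U hTPP
    (fun X hX ℓ h1 h2 => hflat X hX ℓ h1 h2)

/-! ## Proved glue: non-negativity of the spectral masses, the flat case, the crux by name -/

/-- Every character sum `Σ_{x,y∈X} Re χ^μ(x⁻¹y)` is non-negative (it is a Hilbert–Schmidt norm in a unitary
Wedderburn decomposition: `stub_blockDictionary`). -/
theorem charSum_nonneg (μ : Nat.Partition n) (X : Finset (Equiv.Perm (Fin n))) : 0 ≤ charSum μ X := by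
  classical
  obtain ⟨r, d, hd, φ, hφ⟩ :=
    Literature.RepresentationTheory.FiniteGroups.exists_unitary_algEquiv_pi_matrix (Equiv.Perm (Fin n))
  haveI : ∀ i, NeZero (d i) := hd
  obtain ⟨part, hbij, -, -, -, hnorm⟩ := stub_blockDictionary n φ hφ
  obtain ⟨i, rfl⟩ := hbij.2 μ
  rw [charSum, ← hnorm i X]
  exact Literature.Barriers.MatrixMultiplication.re_trace_conjTranspose_mul_self_nonneg _

theorem specMass_nonneg (ℓ : ℕ) (X : Finset (Equiv.Perm (Fin n))) : 0 ≤ specMass ℓ X := by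
  unfold specMass
  exact div_nonneg (Finset.sum_nonneg fun μ _ => charSum_nonneg μ X) (by positivity)

theorem specMassT_nonneg (ℓ : ℕ) (X : Finset (Equiv.Perm (Fin n))) : 0 ≤ specMassT ℓ X := by
  unfold specMassT
  exact div_nonneg (Finset.sum_nonneg fun μ _ => charSum_nonneg μ X) (by positivity)

/-- `N·abc ≤ B` from `N·a³, N·b³, N·c³ ≤ B` for non-negative reals (bound by the largest). -/
theorem mul_prod3_le {N a b c B : ℝ} (hN : 0 ≤ N) (ha : 0 ≤ a) (hb : 0 ≤ b) (hc : 0 ≤ c)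
    (hA : N * a ^ 3 ≤ B) (hB : N * b ^ 3 ≤ B) (hC : N * c ^ 3 ≤ B) : N * (a * b * c) ≤ B := by
  have key : ∀ m : ℝ, a ≤ m → b ≤ m → c ≤ m → N * m ^ 3 ≤ B → N * (a * b * c) ≤ B := by
    intro m ham hbm hcm hm
    have hm0 : 0 ≤ m := ha.trans ham
    have h1 : a * b * c ≤ m ^ 3 := by
      calc a * b * c ≤ m * m * m :=
            mul_le_mul (mul_le_mul ham hbm hb hm0) hcm hc (mul_nonneg hm0 hm0)
        _ = m ^ 3 := by ring
    exact (mul_le_mul_of_nonneg_left h1 hN).trans hm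
  rcases le_total a b with hab | hab <;> rcases le_total b c with hbc | hbc <;>
    rcases le_total a c with hac | hac
  all_goals first
    | exact key c (by linarith) (by linarith) le_rfl hC
    | exact key b (by linarith) le_rfl (by linarith) hB
    | exact key a le_rfl (by linarith) (by linarith) hA

/-- Flat triples have low-level weight `≤ 2/7` (geometric series `2 Σ_{ℓ ≥ 1} 8^{-ℓ} = 2/7`). -/
theorem lowWeight_le (L : ℕ) (S T U : Finset (Equiv.Perm (Fin n)))
    (h : ∀ X : Finset (Equiv.Perm (Fin n)), (X = S ∨ X = T ∨ X = U) →
      ∀ ℓ : ℕ, 1 ≤ ℓ → ℓ ≤ L → FlatAt ℓ X) :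
    lowWeight L S T U ≤ 2 / 7 := by
  unfold lowWeight
  have hterm : ∀ ℓ ∈ Finset.Ico 1 (L + 1), (n.descFactorial ℓ : ℝ) *
      (specMass ℓ S * specMass ℓ T * specMass ℓ U +
        specMassT ℓ S * specMassT ℓ T * specMassT ℓ U) ≤ 2 * (1 / 8 : ℝ) ^ ℓ := by
    intro ℓ hℓ
    rw [Finset.mem_Ico] at hℓ
    have h1 : 1 ≤ ℓ := hℓ.1
    have h2 : ℓ ≤ L := Nat.lt_succ_iff.mp hℓ.2
    obtain ⟨hS1, hS2⟩ := h S (Or.inl rfl) ℓ h1 h2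
    obtain ⟨hT1, hT2⟩ := h T (Or.inr (Or.inl rfl)) ℓ h1 h2
    obtain ⟨hU1, hU2⟩ := h U (Or.inr (Or.inr rfl)) ℓ h1 h2
    have hN : (0 : ℝ) ≤ (n.descFactorial ℓ : ℝ) := Nat.cast_nonneg _
    have hA := mul_prod3_le hN (specMass_nonneg ℓ S) (specMass_nonneg ℓ T) (specMass_nonneg ℓ U)
      hS1 hT1 hU1
    have hB := mul_prod3_le hN (specMassT_nonneg ℓ S) (specMassT_nonneg ℓ T)
      (specMassT_nonneg ℓ U) hS2 hT2 hU2
    rw [mul_add]; linarith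
  calc _ ≤ ∑ ℓ ∈ Finset.Ico 1 (L + 1), 2 * (1 / 8 : ℝ) ^ ℓ := Finset.sum_le_sum hterm
    _ = 2 * ∑ ℓ ∈ Finset.Ico 1 (L + 1), (1 / 8 : ℝ) ^ ℓ := by rw [Finset.mul_sum]
    _ ≤ 2 * ((1 / 8 : ℝ) ^ 1 / (1 - 1 / 8)) := by
        gcongr
        exact geom_sum_Ico_le_of_lt_one (by norm_num) (by norm_num)
    _ = 2 / 7 := by norm_num

/-- `128 · 2ⁿ ≤ n!` for `n ≥ 8`. -/
theorem factorial_ge (n : ℕ) (hn : 8 ≤ n) : 128 * 2 ^ n ≤ n.factorial := by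
  induction n, hn using Nat.le_induction with
  | base => decide
  | succ m hm ih =>
    rw [Nat.factorial_succ, pow_succ]
    calc 128 * (2 ^ m * 2) = 2 * (128 * 2 ^ m) := by ring
      _ ≤ (m + 1) * m.factorial := Nat.mul_le_mul (by omega) ih

/-- `16 e^{2√n} ≤ n!` for `n ≥ 8`. -/
theorem sixteen_exp_le_factorial (n : ℕ) (hn : 8 ≤ n) :
    16 * Real.exp (Real.sqrt n) ^ 2 ≤ (n.factorial : ℝ) := by
  have hsq : Real.sqrt (n : ℝ) ^ 2 = n := Real.sq_sqrt (Nat.cast_nonneg n)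
  have hs0 : 0 ≤ Real.sqrt (n : ℝ) := Real.sqrt_nonneg _
  have h2s : 2 * Real.sqrt (n : ℝ) ≤ 2 + (n : ℝ) / 2 := by
    nlinarith [sq_nonneg (Real.sqrt (n : ℝ) - 2)]
  have he : Real.exp 1 < 2.7182818286 := Real.exp_one_lt_d9
  have he0 : 0 < Real.exp 1 := Real.exp_pos 1
  have hexp2 : Real.exp 2 ≤ 8 := by
    have h' : Real.exp 2 = Real.exp 1 ^ 2 := by rw [← Real.exp_nat_mul]; norm_num
    rw [h']; nlinarith
  have hhalf : Real.exp (1 / 2) ≤ 2 := by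
    have h4 : Real.exp 1 ≤ 4 := by linarith
    rw [Real.exp_half 1]
    calc Real.sqrt (Real.exp 1) ≤ Real.sqrt 4 := Real.sqrt_le_sqrt h4
      _ = 2 := by rw [show (4 : ℝ) = 2 ^ 2 by norm_num, Real.sqrt_sq (by norm_num)]
  have hexpn : Real.exp ((n : ℝ) / 2) ≤ 2 ^ n := by
    have h' : Real.exp ((n : ℝ) / 2) = Real.exp (1 / 2) ^ n := by
      rw [← Real.exp_nat_mul]; congr 1; ring
    rw [h']
    exact pow_le_pow_left₀ (Real.exp_pos _).le hhalf n
  have hfac : (128 : ℝ) * 2 ^ n ≤ (n.factorial : ℝ) := by exact_mod_cast factorial_ge n hn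
  calc 16 * Real.exp (Real.sqrt n) ^ 2 = 16 * Real.exp (2 * Real.sqrt n) := by
        rw [← Real.exp_nat_mul]; norm_num
    _ ≤ 16 * Real.exp (2 + (n : ℝ) / 2) := by gcongr
    _ = 16 * (Real.exp 2 * Real.exp ((n : ℝ) / 2)) := by rw [Real.exp_add]
    _ ≤ 16 * (8 * 2 ^ n) := by gcongr
    _ = 128 * 2 ^ n := by ring
    _ ≤ _ := hfac

/-- The real-variable core of the flat-case arithmetic: from
`V² ≤ F V + F R V / E² + V² Λ`, `Λ ≤ 2/7`, `R ≥ 4E`, `E ≥ 3` conclude `V E ≤ F R`. -/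
theorem flat_arith_core {V Λ F E R : ℝ} (hV : 0 ≤ V) (hΛ : Λ ≤ 2 / 7) (hF0 : 0 < F)
    (hE3 : 3 ≤ E) (hR0 : 0 < R) (hRE : 4 * E ≤ R)
    (h : V ^ 2 ≤ F * V + F * R * V / E ^ 2 + V ^ 2 * Λ) : V * E ≤ F * R := by
  have hE0 : 0 < E := by linarith
  have key : 7 * E ^ 2 + 7 * R ≤ 5 * R * E := by
    nlinarith [mul_nonneg (sub_nonneg.2 hRE) (by linarith : (0 : ℝ) ≤ 5 * E - 7),
      mul_nonneg hE0.le (by linarith : (0 : ℝ) ≤ 13 * E - 28)]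
  rcases hV.eq_or_lt with hV0 | hVpos
  · rw [← hV0, zero_mul]; positivity
  · have hdiv : V ≤ F + F * R / E ^ 2 + V * Λ := by
      have h1 : V * V ≤ V * (F + F * R / E ^ 2 + V * Λ) := by
        have hr : V * (F + F * R / E ^ 2 + V * Λ) = F * V + F * R * V / E ^ 2 + V ^ 2 * Λ := by
          ring
        rw [hr, ← sq]; exact h
      exact le_of_mul_le_mul_left h1 hVpos
    have h57 : 5 / 7 * V ≤ F + F * R / E ^ 2 := by
      nlinarith [mul_le_mul_of_nonneg_left hΛ hV]
    have hE2 : 0 < E ^ 2 := by positivity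
    have h57' : 5 / 7 * V * E ^ 2 ≤ F * E ^ 2 + F * R := by
      have h2 := mul_le_mul_of_nonneg_right h57 hE2.le
      rwa [add_mul, div_mul_cancel₀ _ hE2.ne'] at h2
    have hkeyF : F * E ^ 2 + F * R ≤ 5 / 7 * (F * R * E) := by
      nlinarith [mul_le_mul_of_nonneg_left key hF0.le]
    have h3 : 5 / 7 * V * E ^ 2 ≤ 5 / 7 * (F * R * E) := h57'.trans hkeyF
    have h4 : (V * E) * (5 / 7 * E) ≤ (F * R) * (5 / 7 * E) := by nlinarith [h3]
    exact le_of_mul_le_mul_right h4 (by positivity)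

/-- **The flat case, PROVED from stubs 4 + 7**: for some `c > 0` and all large `n`, a TPP triple all of
whose sets are spectrally flat at every level `1 ≤ ℓ ≤ ⌊√n⌋` has `|S||T||U| ≤ (n!)^{3/2} e^{-c√n}`. -/
theorem flat_case :
    ∃ c : ℝ, 0 < c ∧ ∃ n₃ : ℕ, ∀ n ≥ n₃, ∀ S T U : Finset (Equiv.Perm (Fin n)),
      TripleProductProperty S T U →
      (∀ X : Finset (Equiv.Perm (Fin n)), (X = S ∨ X = T ∨ X = U) →
        ∀ ℓ : ℕ, 1 ≤ ℓ → ℓ ≤ Nat.sqrt n → FlatAt ℓ X) →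
      ((S.card * T.card * U.card : ℕ) : ℝ) ≤
        (n.factorial : ℝ) ^ ((3 : ℝ) / 2) * Real.exp (-(c * Real.sqrt (n : ℝ))) := by
  obtain ⟨c, hc, n₃, h⟩ := stub_flatCase
  refine ⟨c, hc, n₃, fun n hn S T U hTPP hflat => ?_⟩
  exact h n hn specMass specMassT (fun _ _ => rfl) (fun _ _ => rfl) S T U hTPP
    (fun X hX ℓ h1 h2 => hflat X hX ℓ h1 h2)

/-- Sanity (sorry-free modulo stubs 4 and 7): the flat-case stub follows from the truncated count and
the dimension growth — this is the proof landed in `…StubFlatCase.lean`, kept here so that the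
skeleton's composition is visibly `stubs 4, 5, 6, 7 ⇒ GlobalBranch`. -/
theorem flatCase_of_stubs :
    ∃ c : ℝ, 0 < c ∧ ∃ n₃ : ℕ, ∀ n ≥ n₃,
      ∀ (sM sT : ℕ → Finset (Equiv.Perm (Fin n)) → ℝ),
      (∀ (ℓ : ℕ) (X : Finset (Equiv.Perm (Fin n))), sM ℓ X =
        (∑ μ ∈ univ.filter (fun μ : Nat.Partition n =>
            μ ≠ Nat.Partition.indiscrete n ∧ μ.parts.sup = n - ℓ),
          ∑ x ∈ X, ∑ y ∈ X, (spechtCharacter ℂ μ (x⁻¹ * y)).re) / ((X.card : ℝ) ^ 2)) →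
      (∀ (ℓ : ℕ) (X : Finset (Equiv.Perm (Fin n))), sT ℓ X =
        (∑ μ ∈ univ.filter (fun μ : Nat.Partition n =>
            μ ≠ Nat.Partition.indiscrete n ∧ Multiset.card μ.parts = n - ℓ),
          ∑ x ∈ X, ∑ y ∈ X, (spechtCharacter ℂ μ (x⁻¹ * y)).re) / ((X.card : ℝ) ^ 2)) →
      ∀ S T U : Finset (Equiv.Perm (Fin n)), TripleProductProperty S T U →
      (∀ X : Finset (Equiv.Perm (Fin n)), (X = S ∨ X = T ∨ X = U) →
        ∀ ℓ : ℕ, 1 ≤ ℓ → ℓ ≤ Nat.sqrt n →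
          (n.descFactorial ℓ : ℝ) * sM ℓ X ^ 3 ≤ (1 / 8 : ℝ) ^ ℓ ∧
            (n.descFactorial ℓ : ℝ) * sT ℓ X ^ 3 ≤ (1 / 8 : ℝ) ^ ℓ) →
      ((S.card * T.card * U.card : ℕ) : ℝ) ≤
        (n.factorial : ℝ) ^ ((3 : ℝ) / 2) * Real.exp (-(c * Real.sqrt (n : ℝ))) := by
  obtain ⟨c, hc, n₁, hdim⟩ := stub_dimGrowth
  -- work with c' = min c 4
  set c' : ℝ := min c 4 with hc'
  have hc'0 : 0 < c' := lt_min hc (by norm_num)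
  have hc'c : c' ≤ c := min_le_left _ _
  have hc'4 : c' ≤ 4 := min_le_right _ _
  obtain ⟨N, hN⟩ := exists_nat_gt ((8 / c') ^ 2)
  refine ⟨c' / 4, by positivity, max n₁ (max 8 N), ?_⟩
  intro n hn sM sT hsM hsT S T U hTPP hflat
  have hn₁ : n₁ ≤ n := le_trans (le_max_left _ _) hn
  have hn8 : 8 ≤ n := le_trans (le_trans (le_max_left _ _) (le_max_right _ _)) hn
  have hnN : N ≤ n := le_trans (le_trans (le_max_right _ _) (le_max_right _ _)) hn
  have hn1 : 1 ≤ n := le_trans (by norm_num) hn8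
  -- the pinned functions are the spectral masses
  have hsM' : sM = specMass := by
    funext ℓ X; rw [hsM]; rfl
  have hsT' : sT = specMassT := by
    funext ℓ X; rw [hsT]; rfl
  subst hsM' hsT'
  have hΛ : lowWeight (Nat.sqrt n) S T U ≤ 2 / 7 :=
    lowWeight_le (Nat.sqrt n) S T U (fun X hX ℓ h1 h2 => hflat X hX ℓ h1 h2)
  -- the square root of n is large
  have hsqrt : 8 / c' ≤ Real.sqrt (n : ℝ) := by
    rw [Real.le_sqrt (by positivity) (by positivity)]
    have : ((8 / c') ^ 2 : ℝ) ≤ N := hN.le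
    exact this.trans (by exact_mod_cast hnN)
  set s : ℝ := Real.sqrt (n : ℝ) with hs
  have hs0 : 0 ≤ s := Real.sqrt_nonneg _
  set D : ℝ := Real.exp (c' * s) with hDdef
  set E : ℝ := Real.exp (c' * s / 4) with hEdef
  have hD0 : 0 < D := Real.exp_pos _
  have hE0 : 0 < E := Real.exp_pos _
  have hE3 : 3 ≤ E := by
    have h2 : 2 ≤ c' * s / 4 := by
      have := mul_le_mul_of_nonneg_left hsqrt hc'0.le
      rw [mul_div_cancel₀ _ hc'0.ne'] at this
      linarith
    have := Real.add_one_le_exp (c' * s / 4)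
    rw [hEdef]; linarith
  have hsqrtD : Real.sqrt D = E ^ 2 := by
    rw [hDdef, hEdef, ← Real.exp_nat_mul, Real.sqrt_eq_rpow, ← Real.exp_mul]
    congr 1; push_cast; ring
  have hdimD : ∀ μ : Nat.Partition n, Nat.sqrt n < lvl2 μ → D ≤ (numStandardTableaux μ : ℝ) := by
    intro μ hμ
    refine le_trans ?_ (hdim n hn₁ μ hμ)
    rw [hDdef]
    exact Real.exp_le_exp.2 (mul_le_mul_of_nonneg_right hc'c hs0)
  have hcount := truncatedCount n (Nat.sqrt n) hn1 D hD0 hdimD S T U hTPP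
  have hF0 : (0 : ℝ) < n.factorial := by exact_mod_cast n.factorial_pos
  set F : ℝ := (n.factorial : ℝ) with hFdef
  set R : ℝ := Real.sqrt F with hRdef
  have hR0 : 0 < R := Real.sqrt_pos.2 hF0
  have h32 : F ^ ((3 : ℝ) / 2) = F * R := by
    rw [show (3 : ℝ) / 2 = 1 + 1 / 2 by norm_num, Real.rpow_add hF0, Real.rpow_one, hRdef,
      Real.sqrt_eq_rpow]
  have hRE : 4 * E ≤ R := by
    have hE2 : E ^ 2 ≤ Real.exp s ^ 2 := by
      rw [hEdef, ← Real.exp_nat_mul, ← Real.exp_nat_mul, Real.exp_le_exp]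
      push_cast
      nlinarith [mul_le_mul_of_nonneg_right hc'4 hs0]
    have h16 : 16 * E ^ 2 ≤ F := le_trans (by nlinarith [hE2]) (sixteen_exp_le_factorial n hn8)
    rw [hRdef, Real.le_sqrt (by positivity) hF0.le]
    nlinarith [h16]
  have hV : (0 : ℝ) ≤ ((S.card * T.card * U.card : ℕ) : ℝ) := Nat.cast_nonneg _
  rw [h32, hsqrtD] at hcount
  have hmain := flat_arith_core hV hΛ hF0 hE3 hR0 hRE hcount
  rw [h32, show -(c' / 4 * s) = -(c' * s / 4) by ring, Real.exp_neg, ← hEdef, ← div_eq_mul_inv,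
    le_div_iff₀ hE0]
  exact hmain

/-- Weakening the decay constant. -/
theorem subthreshold_mono {c c' : ℝ} (hc : c' ≤ c) {V : ℝ}
    (h : V ≤ (n.factorial : ℝ) ^ ((3 : ℝ) / 2) * Real.exp (-(c * Real.sqrt (n : ℝ)))) :
    V ≤ (n.factorial : ℝ) ^ ((3 : ℝ) / 2) * Real.exp (-(c' * Real.sqrt (n : ℝ))) := by
  refine h.trans (mul_le_mul_of_nonneg_left ?_ (by positivity))
  apply Real.exp_le_exp.2
  have h0 : 0 ≤ Real.sqrt (n : ℝ) := Real.sqrt_nonneg _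
  nlinarith [mul_le_mul_of_nonneg_right hc h0]

/-- **THE SKELETON THEOREM**: the stubs imply the crux `GlobalBranch` (concluded BY NAME).
Constants: `ε` from the residual stub 5, `c = min c₅ c₈`, `n₀ = max n₅ (max n₈ 1)`; cases: some set is
spectrally non-flat at some level `1 ≤ ℓ ≤ ⌊√n⌋` (stub 5) / all three sets are flat at every such level
(`flat_case` = stub 8, itself proved from stubs 4 + 7 — `flatCase_of_stubs`). -/
theorem GlobalBranch_of : GlobalBranch := by
  obtain ⟨ε, hε, c₅, hc₅, n₅, hR⟩ := stub_coherentResidual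
  obtain ⟨c₈, hc₈, n₈, hF⟩ := flat_case
  unfold Summit.MatrixMultiplication.MatrixMultiplication.Theses.SnSubsetDichotomy.GlobalBranch
  refine ⟨ε, hε, min c₅ c₈, lt_min hc₅ hc₈, max n₅ (max n₈ 1), ?_⟩
  intro n hn S T U hTPP hbump
  have hn₅ : n₅ ≤ n := le_trans (le_max_left _ _) hn
  have hn₈ : n₈ ≤ n := le_trans (le_trans (le_max_left _ _) (le_max_right _ _)) hn
  have hb : BumpFree ε S T U := hbump
  by_cases hA : ∃ X : Finset (Equiv.Perm (Fin n)), (X = S ∨ X = T ∨ X = U) ∧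
      ∃ ℓ : ℕ, 1 ≤ ℓ ∧ ℓ ≤ Nat.sqrt n ∧ ¬ FlatAt ℓ X
  · exact subthreshold_mono (min_le_left _ _) (hR n hn₅ S T U hTPP hb hA)
  · push Not at hA
    exact subthreshold_mono (min_le_right _ _) (hF n hn₈ S T U hTPP fun X hX ℓ h1 h2 => hA X hX ℓ h1 h2)

end

end Summit.MatrixMultiplication.MatrixMultiplication.Cruxes.GlobalBranch.FlatTailTruncation
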